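import Literature.Analysis.FluidPDE.AlexakisDoering
import Literature.Analysis.FluidPDE.AlexakisDoeringInterpolation
import Literature.Analysis.FluidPDE.LerayHopfSpectralMeasurability
import Literature.Analysis.FluidPDE.NSStrongSolutions2DProofs
import Literature.Analysis.FluidPDE.NSUniqueness2DParts
import Literature.Analysis.FluidPDE.NSUniqueness2DLadyzhenskaya
import Literature.Analysis.FluidPDE.NSLerayHopf
import Literature.Analysis.FluidPDE.ZerothLawProofs
import Literature.Analysis.FunctionSpaces.TorusFourierCalculus
import HarnessLib

/-!
# The Alexakis–Doering interpolation step `ε² ≤ ν U² χ` from strong existence and 2-D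
  uniqueness

Proof layer for the named fact `Literature.Analysis.FluidPDE.AlexakisDoering2006_dissipation_sq_le`
(`AlexakisDoering`; Alexakis–Doering, Phys. Lett. A 359 (2006), §2, display "(trickI)" / arXiv
eq. (21): `⟨ω²⟩² = ⟨u·∇×(k̂ω)⟩² ≤ ⟨|u|²⟩⟨|∇ω|²⟩`, i.e. `ε² ≤ ν U² χ`), complementary to
`AlexakisDoeringProofs` (which derives the fact from the enstrophy *balance*
`fmrt_enstrophy_balance_torus2`). Here the 2-D regularity input is split differently, along
Foias–Manley–Rosa–Temam 2001, Ch. II, Thm. 7.3 (uniqueness) + Thm. 7.4 (strong existence):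

* `AlexakisDoering2006_dissipation_sq_le_of_regularity` — **core** (any `d`): a global
  Leray–Hopf solution with `u ∈ L²(0,T;H²)` for all `T` and an integrated enstrophy bound of the
  form `ν∫₀ᵗ‖Δu‖₂² ≤ A + B t + C∫₀ᵗ‖u‖₂²` (`C ≥ 0`) satisfies `ε² ≤ ν U² χ` whenever `U > 0`
  (the accepted `meanDissipation_sq_le_of_regular` of `AlexakisDoeringInterpolation` plus the
  measurability layer `LerayHopfSpectralMeasurability`; the running means of `‖Δu‖₂²` are
  eventually bounded by `isBoundedUnder_timeMean_of_setIntegral_le`);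
* `AlexakisDoering2006_dissipation_sq_le_of_strong_of_uniqueness` — the fact follows from
  strong existence with the enstrophy inequality (`fmrt_strong_existence_torus2`, PROVED as
  `fmrt_strong_existence_torus2_holds` in `NSStrongSolutions2DProofs`) and 2-D uniqueness
  (`lions_prodi_uniqueness_torus2`, `NSUniqueness2D`, FMRT Thm. 7.3), which transfers the
  regularity to every Leray–Hopf solution
  (`lions_prodi_uniqueness_torus2.enstrophy_regularity`, `NSStrongSolutions2D`), and for the
  steady smooth force `f = F Φ(n • ·)` the bound reads `ν∫₀ᵗ‖Δu‖₂² ≤ ‖∇u₀‖₂² + ν⁻¹‖f‖₂² t`;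
* `AlexakisDoering2006_dissipation_sq_le_of_difference_ineq` — equivalently from the named
  input `lions_prodi_difference_ineq_torus2` of `NSUniqueness2DParts` (the energy inequality for
  the difference of two Leray–Hopf solutions), through the accepted assembly
  `lions_prodi_uniqueness_torus2_of_parts` and `ladyzhenskaya_torus2_holds` (cf. the parallel
  `Literature.Barriers.AnomalousDissipation.AlexakisDoering2006_dissipation_sq_le_of_lionsProdi`,
  which goes through `NSEnstrophyLimit2D` instead of `fmrt_strong_existence_torus2`).

So the trust base of `AlexakisDoering2006_dissipation_sq_le` along this route is the single
2-D input `lions_prodi_difference_ineq_torus2` (Lions–Prodi 1959; FMRT (A.44)–(A.52)).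

## References

* A. Alexakis, C. R. Doering, Phys. Lett. A 359 (2006), §2 (arXiv:physics/0605090, eq. (21)).
  [AlexakisDoering2006PLA]
* C. Foias, O. Manley, R. Rosa, R. Temam, *Navier–Stokes Equations and Turbulence*, CUP 2001,
  Ch. II Thm. 7.3–7.4, (7.16)–(7.17), App. A (A.65)–(A.67). [FoiasManleyRosaTemam2001]
-/

open MeasureTheory Filter Set
open scoped ENNReal NNReal RealInnerProductSpace

noncomputable section

namespace Literature.Analysis.FluidPDE

open Literature.Analysis.FunctionSpaces

/-! ### Running means from integrated bounds -/

section Means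

/-- For `0 ≤ t`, the running mean is `t⁻¹` times the set integral over `(0, t]`
(`intervalIntegral.integral_of_le`). [folklore] -/
theorem timeMean_eq_inv_mul_setIntegral (g : ℝ → ℝ) {t : ℝ} (ht : 0 ≤ t) :
    timeMean g t = t⁻¹ * ∫ s in Ioc 0 t, g s := by
  unfold timeMean
  rw [intervalIntegral.integral_of_le ht]

/-- **Eventually bounded running means from an integrated bound.** If
`∫_{(0,t]} L ≤ A + B t + C ∫_{(0,t]} E` for every `t > 0` with `C ≥ 0`, and the running means
`t⁻¹∫₀ᵗ E` are eventually bounded above, then so are the running means `t⁻¹∫₀ᵗ L`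
(for `t ≥ 1`: `t⁻¹∫₀ᵗ L ≤ |A| + |B| + C · t⁻¹∫₀ᵗ E`). [folklore] -/
theorem isBoundedUnder_timeMean_of_setIntegral_le {L E : ℝ → ℝ} {A B C : ℝ} (hC : 0 ≤ C)
    (h : ∀ t, 0 < t → ∫ s in Ioc 0 t, L s ≤ A + B * t + C * ∫ s in Ioc 0 t, E s)
    (hE : IsBoundedUnder (· ≤ ·) atTop (timeMean E)) :
    IsBoundedUnder (· ≤ ·) atTop (timeMean L) := by
  obtain ⟨M, hM⟩ := hE
  rw [Filter.eventually_map] at hM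
  refine ⟨|A| + |B| + C * |M|, ?_⟩
  rw [Filter.eventually_map]
  filter_upwards [hM, eventually_ge_atTop (1 : ℝ)] with t htM ht1
  have ht : 0 < t := by linarith
  have htinv : 0 ≤ t⁻¹ := by positivity
  have htinv1 : t⁻¹ ≤ 1 := inv_le_one_of_one_le₀ ht1
  rw [timeMean_eq_inv_mul_setIntegral _ ht.le] at htM ⊢
  calc t⁻¹ * ∫ s in Ioc 0 t, L s
      ≤ t⁻¹ * (A + B * t + C * ∫ s in Ioc 0 t, E s) := mul_le_mul_of_nonneg_left (h t ht) htinv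
    _ = t⁻¹ * A + B + C * (t⁻¹ * ∫ s in Ioc 0 t, E s) := by field_simp
    _ ≤ |A| + |B| + C * |M| := by
        have h1 : t⁻¹ * A ≤ |A| := by
          calc t⁻¹ * A ≤ t⁻¹ * |A| := mul_le_mul_of_nonneg_left (le_abs_self A) htinv
            _ ≤ 1 * |A| := mul_le_mul_of_nonneg_right htinv1 (abs_nonneg A)
            _ = |A| := one_mul _
        have h2 : B ≤ |B| := le_abs_self B
        have h3 : C * (t⁻¹ * ∫ s in Ioc 0 t, E s) ≤ C * |M| :=
          mul_le_mul_of_nonneg_left (htM.trans (le_abs_self M)) hC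
        linarith

end Means

/-! ### The core reduction on `T^d` -/

section Core

variable {d : Type*} [Fintype d] [DecidableEq d]

/-- **`ε² ≤ ν U² χ` for globally regular Leray–Hopf solutions** (the content of Alexakis–Doering
2006, §2, "(trickI)", on the tree's renderings). Let `ν > 0` and let `u` be a global Leray–Hopf
solution on `T^d` (any force, any datum) such that `u ∈ L²(0,T;H²)` for every `T > 0`
(spectrally, `Torus.MemL2Sobolev 0 T 2` of the complexified field) and, for some constants
`A, B` and `C ≥ 0`, `ν ∫_{(0,t]} ‖Δu‖₂² ≤ A + B t + C ∫_{(0,t]} ‖u‖₂²` for every `t > 0` (an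
integrated enstrophy inequality). If `U = ⟨‖u‖₂²⟩^{1/2} > 0` then `ε² ≤ ν U² χ` with
`ε = meanDissipation ν u`, `χ = meanEnstrophyDissipation ν u`. Proof: the hypotheses of
`meanDissipation_sq_le_of_regular` are supplied by `LerayHopfSpectralMeasurability`
(measurability, `L²` slices, a.e. finiteness and local integrability of `‖Δu‖₂²` from `L²H²`),
by `isBoundedUnder_timeMean_of_rmsVelocity_pos` (`U > 0` bounds the energy means) and by
`isBoundedUnder_timeMean_of_setIntegral_le`. [cite: AlexakisDoering2006PLA, §2 display (trickI)] -/
theorem AlexakisDoering2006_dissipation_sq_le_of_regularity {ν : ℝ} (hν : 0 < ν)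
    {f u : ℝ → UnitAddTorus d → EuclideanSpace ℝ d} {u₀ : UnitAddTorus d → EuclideanSpace ℝ d}
    (hu : Torus.IsGlobalLerayHopf ν f u₀ u)
    (hH2 : ∀ T, 0 < T → Torus.MemL2Sobolev 0 T 2 (fun t => EuclideanSpace.complexify ∘ u t))
    {A B C : ℝ} (hC : 0 ≤ C)
    (hEns : ∀ t, 0 < t → ν * ∫ s in Ioc 0 t, (eLaplacianNormSq (u s)).toReal ≤
      A + B * t + C * ∫ s in Ioc 0 t, ∫ x, ‖u s x‖ ^ 2)
    (hU : 0 < rmsVelocity longTimeAvgSup u) :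
    meanDissipation ν u ^ 2 ≤
      ν * rmsVelocity longTimeAvgSup u ^ 2 * meanEnstrophyDissipation ν u := by
  have hL2 : ∀ᵐ t ∂(volume.restrict (Ioi (0 : ℝ))), MemLp (u t) 2 volume :=
    (ae_restrict_mem measurableSet_Ioi).mono fun t ht => hu.memLp_two (le_of_lt ht)
  have hEb := isBoundedUnder_timeMean_of_rmsVelocity_pos hU
  -- running means of `‖Δu‖₂²` from the integrated enstrophy inequality (divide by `ν`)
  have hLb : IsBoundedUnder (· ≤ ·) atTop
      (timeMean fun t => (eLaplacianNormSq (u t)).toReal) := by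
    refine isBoundedUnder_timeMean_of_setIntegral_le (A := A / ν) (B := B / ν) (C := C / ν)
      (div_nonneg hC hν.le) (fun t ht => ?_) hEb
    have h : (∫ s in Ioc 0 t, (eLaplacianNormSq (u s)).toReal) ≤
        (A + B * t + C * ∫ s in Ioc 0 t, ∫ x, ‖u s x‖ ^ 2) / ν := (le_div_iff₀' hν).mpr (hEns t ht)
    have : (A + B * t + C * ∫ s in Ioc 0 t, ∫ x, ‖u s x‖ ^ 2) / ν =
        A / ν + B / ν * t + C / ν * ∫ s in Ioc 0 t, ∫ x, ‖u s x‖ ^ 2 := by ring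
    rwa [this] at h
  exact meanDissipation_sq_le_of_regular hν.le hL2 (hu.ae_eLaplacianNormSq_ne_top hH2)
    hu.aestronglyMeasurable_toReal_eGradNormSq (fun T hT => hu.integrableOn_integral_norm_sq hT)
    (fun T hT => (hu T hT).integrableOn_toReal_eLaplacianNormSq (hH2 T hT)) hEb hLb

/-- From the `ℝ≥0∞` enstrophy inequality to the real integrated bound: if along a global
Leray–Hopf solution `‖∇u(t)‖₂² + ν∫⁻_{(0,t)}‖Δu‖₂² ≤ G₀ + ν⁻¹ X_t` in `[0,∞]` with
`G₀, X_t < ∞`, then `ν ∫_{(0,t]} (‖Δu‖₂²).toReal ≤ G₀.toReal + ν⁻¹ X_t.toReal` (`t > 0`). [folklore] -/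
theorem mul_setIntegral_toReal_eLaplacianNormSq_le {ν : ℝ} (hν : 0 < ν)
    {f u : ℝ → UnitAddTorus d → EuclideanSpace ℝ d} {u₀ : UnitAddTorus d → EuclideanSpace ℝ d}
    (hu : Torus.IsGlobalLerayHopf ν f u₀ u) {t : ℝ} (ht : 0 < t) {G₀ X : ℝ≥0∞} (hG₀ : G₀ ≠ ∞)
    (hX : X ≠ ∞)
    (h : Torus.eGradNormSq (u t) + ENNReal.ofReal ν * ∫⁻ s in Ioo 0 t, eLaplacianNormSq (u s) ≤
      G₀ + ENNReal.ofReal ν⁻¹ * X) :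
    ν * ∫ s in Ioc 0 t, (eLaplacianNormSq (u s)).toReal ≤ G₀.toReal + ν⁻¹ * X.toReal := by
  have hrhs : G₀ + ENNReal.ofReal ν⁻¹ * X ≠ ∞ :=
    ENNReal.add_ne_top.2 ⟨hG₀, ENNReal.mul_ne_top ENNReal.ofReal_ne_top hX⟩
  have h1 : ENNReal.ofReal ν * ∫⁻ s in Ioo 0 t, eLaplacianNormSq (u s) ≤ G₀ + ENNReal.ofReal ν⁻¹ * X :=
    le_add_self.trans h
  have hfin : ∫⁻ s in Ioo 0 t, eLaplacianNormSq (u s) ≠ ∞ :=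
    (ENNReal.lt_top_of_mul_ne_top_right (ne_top_of_le_ne_top hrhs h1)
      ((ENNReal.ofReal_pos.2 hν).ne')).ne
  -- the Bochner integral over `(0, t]` is the `toReal` of the lower integral over `(0, t)`
  have hmeas : AEMeasurable (fun s => eLaplacianNormSq (u s)) (volume.restrict (Ioo 0 t)) :=
    (hu t ht).aemeasurable_eLaplacianNormSq
  have heq : ∫ s in Ioc 0 t, (eLaplacianNormSq (u s)).toReal =
      (∫⁻ s in Ioo 0 t, eLaplacianNormSq (u s)).toReal := by
    rw [integral_Ioc_eq_integral_Ioo]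
    exact integral_toReal hmeas (ae_lt_top' hmeas hfin)
  rw [heq]
  have h2 := (ENNReal.toReal_le_toReal (ENNReal.mul_ne_top ENNReal.ofReal_ne_top hfin) hrhs).2 h1
  rwa [ENNReal.toReal_mul, ENNReal.toReal_ofReal hν.le, ENNReal.toReal_add hG₀
    (ENNReal.mul_ne_top ENNReal.ofReal_ne_top hX), ENNReal.toReal_mul,
    ENNReal.toReal_ofReal (inv_nonneg.2 hν.le)] at h2

end Core

/-! ### The named fact from strong existence and 2-D uniqueness -/

section TwoD

/-- **Alexakis–Doering's "(trickI)" `ε² ≤ ν U² χ` from strong existence and 2-D uniqueness**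
(Alexakis–Doering 2006, §2, eq. (21); the regularity inputs are Foias–Manley–Rosa–Temam 2001,
Ch. II: Thm. 7.4 — strong existence with the enstrophy inequality, `fmrt_strong_existence_torus2`,
proved in `NSStrongSolutions2DProofs` — and Thm. 7.3, uniqueness of Leray–Hopf weak solutions on
`𝕋²`, the named fact `lions_prodi_uniqueness_torus2`). For a forcing shape `Φ`, `ν > 0`, `n > 0`, amplitude `F`, a
smooth datum `u₀` and a global Leray–Hopf solution `u` forced by `f = F Φ(n • ·)` with `U > 0`:
`f` is smooth (`ForcingShape.force_regular_holds`), `u₀ ∈ H¹` is weakly divergence free, so by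
`lions_prodi_uniqueness_torus2.enstrophy_regularity` `u ∈ L²(0,T;H²)` and
`ν∫₀ᵗ‖Δu‖₂² ≤ ‖∇u₀‖₂² + ν⁻¹ t ‖f‖₂²`; `AlexakisDoering2006_dissipation_sq_le_of_regularity`
concludes. [cite: AlexakisDoering2006PLA, §2 display (trickI)] -/
theorem AlexakisDoering2006_dissipation_sq_le_of_strong_of_uniqueness
    (hS : fmrt_strong_existence_torus2) (hU : lions_prodi_uniqueness_torus2) :
    AlexakisDoering2006_dissipation_sq_le := by
  intro Φ ν hν n hn F u₀ u hu₀ hu hUpos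
  obtain ⟨hfs, -, -⟩ := ForcingShape.force_regular_holds Φ hn F
  set f := Φ.force n F with hf_def
  have hu₀' : Torus.MemSobolev 1 (EuclideanSpace.complexify ∘ u₀) :=
    hu₀.memSobolev_one_complexify
  have hdiv : Torus.IsWeaklyDivFree u₀ := hu.isWeaklyDivFree_datum
  have hfm := aestronglyMeasurable_stLift_const hfs
    (volume.restrict (Ioi (0 : ℝ) ×ˢ (univ : Set (EuclideanSpace ℝ (Fin 2)))))
  have hf₂ : ∀ T : ℝ, 0 < T → ∫⁻ _ in Ioo 0 T, ∫⁻ x, ‖f x‖ₑ ^ 2 < ∞ := fun T _ =>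
    lintegral_enorm_sq_const_lt_top hfs T
  obtain ⟨hH2, hEns⟩ := hU.enstrophy_regularity hS hν hu₀' hdiv hfm hf₂ hu
  have hG₀ : Torus.eGradNormSq u₀ ≠ ∞ := (Torus.eGradNormSq_lt_top hu₀).ne
  refine AlexakisDoering2006_dissipation_sq_le_of_regularity hν hu hH2
    (A := (Torus.eGradNormSq u₀).toReal) (B := ν⁻¹ * ∫ x, ‖f x‖ ^ 2) (C := 0) le_rfl
    (fun t ht => ?_) hUpos
  have hX : ∫⁻ _ in Ioo 0 t, ∫⁻ x, ‖f x‖ₑ ^ 2 ≠ ∞ := (hf₂ t ht).ne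
  have h := mul_setIntegral_toReal_eLaplacianNormSq_le hν hu ht hG₀ hX (hEns t ht)
  have hXval : (∫⁻ _ in Ioo 0 t, ∫⁻ x, ‖f x‖ₑ ^ 2).toReal = t * ∫ x, ‖f x‖ ^ 2 := by
    have hI : 0 ≤ ∫ x, ‖f x‖ ^ 2 := integral_nonneg fun x => sq_nonneg _
    rw [setLIntegral_const, lintegral_enorm_sq_eq_ofReal (hfs.memLp 2), Real.volume_Ioo, sub_zero,
      ← ENNReal.ofReal_mul hI, ENNReal.toReal_ofReal (mul_nonneg hI ht.le), mul_comm]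
  rw [hXval] at h
  linarith

/-- **The same from the difference inequality** (`lions_prodi_difference_ineq_torus2`,
`NSUniqueness2DParts`: FMRT (A.44)–(A.52), Kuksin–Shirikyan (2.26)), through the accepted
assembly `lions_prodi_uniqueness_torus2_of_parts` and the proved Ladyzhenskaya inequality
`ladyzhenskaya_torus2_holds`. [cite: AlexakisDoering2006PLA, §2 display (trickI)] -/
theorem AlexakisDoering2006_dissipation_sq_le_of_difference_ineq
    (hD : lions_prodi_difference_ineq_torus2) : AlexakisDoering2006_dissipation_sq_le :=
  AlexakisDoering2006_dissipation_sq_le_of_strong_of_uniqueness fmrt_strong_existence_torus2_holds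
    (lions_prodi_uniqueness_torus2_of_parts ladyzhenskaya_torus2_holds hD)

end TwoD

end Literature.Analysis.FluidPDE

end
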